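import Mathlib
import HarnessLib
import Summits.QuantumFields.YangMills.Theorems.FemtoCurvatureSkewness.Negative.WeakCoupling

/-!
# `FemtoCurvatureSkewness`, line `coupling-cubic-response` — stub I `PressureCGF`

Cumulant-generating-function identities for the torus Wilson state (crux `stmt-QuantumFields-9365`,
`LangevinControlUV.FemtoCurvatureSkewness`).  With the source-extended partition function
`Z(t₀,t₂,t₃) = ∫ exp(−βS − t₀P₀ − t₂P_{ne₂} − t₃P_{ne₃}) dHaar^{⊗E}` of the torus `(ℤ/L)⁴` (the couplings of the
three marked `(0,1)`-plaquettes at `0`, `ne₂`, `ne₃` shifted by real sources),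

* `∂³_{t₀t₂t₃} log Z |₀ = −κ₃(P_0^{01}, P_{ne₂}^{01}, P_{ne₃}^{01})` (the crux's third cumulant `kappa3`), and
* `∂²_{t₀t₂} log Z(t₀,t₂,0) |₀ = Cov(P_0^{01}, P_{ne₂}^{01})` (the axis covariance `wCov`).

§1 is generic calculus on a compact space with a finite measure: differentiation under the integral sign of
exponential tilts `t ↦ ∫ F e^{H − tP}` (dominated differentiation, `hasDerivAt_integral_of_dominated_loc_of_deriv_le`),
the first log-derivative of the tilted mass, the derivative of a tilted mean, and the two/three-fold iterated
coupling-derivatives of `log ∫ e^{h − t₀X − t₂Y − t₃Z}` at the origin in closed form.  §2 specialises to the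
compact configuration space `GaugeConfig 4 L G` with product Haar measure and identifies the tilted means at the
origin with the Wilson expectation `wE` (`wE_eq_inv_mul_integral`, `E_β[1] = 1`).
-/

noncomputable section

namespace Summit.QuantumFields.YangMills.Theorems.FemtoCurvatureSkewness

open MeasureTheory Filter Topology
open Literature.MathematicalPhysics.QuantumFieldTheory
open Summit.QuantumFields.YangMills.Theorems.ContinuumLimitOnTrajectory.Negative
open Summit.QuantumFields.YangMills.Theorems.FemtoCurvatureSkewness.Negative

/-! ## §1 Calculus of exponential tilts on a compact space -/

section Tilt

variable {Ω : Type*} [MeasurableSpace Ω] [TopologicalSpace Ω] [OpensMeasurableSpace Ω] [CompactSpace Ω]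
  {μ : Measure Ω} [IsFiniteMeasure μ]

/-- **Differentiation under the integral sign for exponential tilts.**  For continuous `H P f` and `g = P·f`,
`t ↦ ∫ f e^{H − tP} dμ` has derivative `−∫ g e^{H − t₀P} dμ` at every `t₀` (dominated differentiation on the unit
ball around `t₀`, with the continuous bound `|f|·|P|·e^{|H| + (|t₀|+1)|P|}`; continuous functions on the compact `Ω`
are `μ`-integrable, `Continuous.integrable_of_hasCompactSupport`). -/
theorem hasDerivAt_integral_mul_exp_tilt {H P f g : Ω → ℝ} (hH : Continuous H) (hP : Continuous P)
    (hf : Continuous f) (hg : ∀ U, g U = P U * f U) (t₀ : ℝ) :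
    HasDerivAt (fun t : ℝ => ∫ U, f U * Real.exp (H U - t * P U) ∂μ)
      (-(∫ U, g U * Real.exp (H U - t₀ * P U) ∂μ)) t₀ := by
  have key := hasDerivAt_integral_of_dominated_loc_of_deriv_le (μ := μ) (x₀ := t₀)
    (s := Metric.ball t₀ 1)
    (bound := fun U => |f U| * (|P U| * Real.exp (|H U| + (|t₀| + 1) * |P U|)))
    (F := fun (t : ℝ) (U : Ω) => f U * Real.exp (H U - t * P U))
    (F' := fun (t : ℝ) (U : Ω) => f U * (-(P U) * Real.exp (H U - t * P U)))
    (Metric.ball_mem_nhds t₀ one_pos) ?_ ?_ ?_ ?_ ?_ ?_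
  · have h2 : HasDerivAt (fun t : ℝ => ∫ U, f U * Real.exp (H U - t * P U) ∂μ)
        (∫ U, f U * (-(P U) * Real.exp (H U - t₀ * P U)) ∂μ) t₀ := key.2
    refine h2.congr_deriv ?_
    rw [← integral_neg]
    refine integral_congr_ae (ae_of_all _ fun U => ?_)
    simp only [hg U]
    ring
  · exact Eventually.of_forall fun t => (Continuous.integrable_of_hasCompactSupport (μ := μ) (by fun_prop)
      (HasCompactSupport.of_compactSpace _)).aestronglyMeasurable
  · exact Continuous.integrable_of_hasCompactSupport (by fun_prop) (HasCompactSupport.of_compactSpace _)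
  · exact (Continuous.integrable_of_hasCompactSupport (μ := μ) (by fun_prop)
      (HasCompactSupport.of_compactSpace _)).aestronglyMeasurable
  · refine ae_of_all _ fun U t ht => ?_
    rw [Real.norm_eq_abs, abs_mul, abs_mul, abs_neg, Real.abs_exp]
    have ht' : |t| ≤ |t₀| + 1 := by
      have hd : |t - t₀| < 1 := by simpa only [Metric.mem_ball, Real.dist_eq] using ht
      calc |t| = |t - t₀ + t₀| := by rw [sub_add_cancel]
        _ ≤ |t - t₀| + |t₀| := abs_add_le _ _
        _ ≤ |t₀| + 1 := by linarith
    have h1 : H U ≤ |H U| := le_abs_self _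
    have h2 : -(t * P U) ≤ (|t₀| + 1) * |P U| :=
      calc -(t * P U) ≤ |t * P U| := neg_le_abs _
        _ = |t| * |P U| := abs_mul _ _
        _ ≤ (|t₀| + 1) * |P U| := mul_le_mul_of_nonneg_right ht' (abs_nonneg _)
    exact mul_le_mul_of_nonneg_left (mul_le_mul_of_nonneg_left
      (Real.exp_le_exp.2 (by linarith)) (abs_nonneg _)) (abs_nonneg _)
  · exact Continuous.integrable_of_hasCompactSupport (by fun_prop) (HasCompactSupport.of_compactSpace _)
  · refine ae_of_all _ fun U t _ => ?_
    have h := (((hasDerivAt_id' t).mul_const (P U)).const_sub (H U)).exp.const_mul (f U)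
    convert h using 1 <;> first | rfl | ring

/-- The mass of the tilt: `t ↦ ∫ e^{H − tP} dμ` has derivative `−∫ P e^{H − t₀P} dμ`. -/
theorem hasDerivAt_integral_exp_tilt {H P : Ω → ℝ} (hH : Continuous H) (hP : Continuous P) (t₀ : ℝ) :
    HasDerivAt (fun t : ℝ => ∫ U, Real.exp (H U - t * P U) ∂μ)
      (-(∫ U, P U * Real.exp (H U - t₀ * P U) ∂μ)) t₀ := by
  have h := hasDerivAt_integral_mul_exp_tilt (μ := μ) (f := fun _ => (1 : ℝ)) (g := P) hH hP
    continuous_const (fun U => (mul_one _).symm) t₀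
  simpa only [one_mul] using h

variable [NeZero μ]

/-- `0 < ∫ e^{H} dμ` for continuous `H` (`μ ≠ 0`). -/
theorem integral_exp_pos_of_continuous {H : Ω → ℝ} (hH : Continuous H) :
    0 < ∫ U, Real.exp (H U) ∂μ :=
  integral_exp_pos (Continuous.integrable_of_hasCompactSupport (by fun_prop) (HasCompactSupport.of_compactSpace _))

/-- **First log-derivative of the tilted mass** at the origin: `(log ∫ e^{H − tP})'(0) = −(∫ P e^H)/(∫ e^H)`. -/
theorem deriv_log_integral_exp_tilt {H P : Ω → ℝ} (hH : Continuous H) (hP : Continuous P) :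
    deriv (fun t : ℝ => Real.log (∫ U, Real.exp (H U - t * P U) ∂μ)) 0 =
      -(∫ U, P U * Real.exp (H U) ∂μ) / ∫ U, Real.exp (H U) ∂μ := by
  have h1 := hasDerivAt_integral_exp_tilt (μ := μ) hH hP 0
  have hZ : (fun t : ℝ => ∫ U, Real.exp (H U - t * P U) ∂μ) 0 ≠ 0 := by
    simpa only [zero_mul, sub_zero] using (integral_exp_pos_of_continuous (μ := μ) hH).ne'
  have key : deriv (fun t : ℝ => Real.log (∫ U, Real.exp (H U - t * P U) ∂μ)) 0 = _ := (h1.log hZ).deriv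
  rw [key]
  simp only [zero_mul, sub_zero]

/-- **Derivative of (minus) a tilted mean** at the origin:
`(−(∫ f e^{H−tP})/(∫ e^{H−tP}))'(0) = ((∫ Pf e^H)(∫ e^H) − (∫ f e^H)(∫ P e^H)) / (∫ e^H)²`. -/
theorem deriv_neg_tilt_mean {H P f g : Ω → ℝ} (hH : Continuous H) (hP : Continuous P)
    (hf : Continuous f) (hg : ∀ U, g U = P U * f U) :
    deriv (fun t : ℝ => -(∫ U, f U * Real.exp (H U - t * P U) ∂μ) / ∫ U, Real.exp (H U - t * P U) ∂μ) 0 =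
      ((∫ U, g U * Real.exp (H U) ∂μ) * (∫ U, Real.exp (H U) ∂μ) -
          (∫ U, f U * Real.exp (H U) ∂μ) * (∫ U, P U * Real.exp (H U) ∂μ)) /
        ((∫ U, Real.exp (H U) ∂μ) * (∫ U, Real.exp (H U) ∂μ)) := by
  have hb0 := (integral_exp_pos_of_continuous (μ := μ) hH).ne'
  have hN := (hasDerivAt_integral_mul_exp_tilt (μ := μ) hH hP hf hg 0).fun_neg
  have hD := hasDerivAt_integral_exp_tilt (μ := μ) hH hP 0
  have key : deriv (fun t : ℝ => -(∫ U, f U * Real.exp (H U - t * P U) ∂μ) /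
      ∫ U, Real.exp (H U - t * P U) ∂μ) 0 = _ :=
    (hN.fun_div hD (by simpa only [zero_mul, sub_zero] using hb0)).deriv
  rw [key]
  simp only [zero_mul, sub_zero, neg_neg, mul_neg]
  field_simp

/-- **Iterated coupling-derivatives of the tilted pressure** `log ∫ e^{h − t₀X − t₂Y − t₃Z} dμ` at the origin, in
terms of the tilted state `E[F] = (∫ F e^h)/(∫ e^h)`: the third mixed derivative is minus the third cumulant
`−(E[XYZ] − E X·Cov(Y,Z) − E Y·Cov(X,Z) − E Z·Cov(X,Y) − E X E Y E Z)` and the second mixed derivative (at `t₃ = 0`)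
is the covariance `E[XY] − E X E Y`. -/
theorem deriv3_deriv2_log_integral_exp {h X Y Z : Ω → ℝ} (hh : Continuous h) (hX : Continuous X)
    (hY : Continuous Y) (hZ : Continuous Z) (E : (Ω → ℝ) → ℝ)
    (hE : ∀ F : Ω → ℝ, E F = (∫ U, F U * Real.exp (h U) ∂μ) / ∫ U, Real.exp (h U) ∂μ) :
    deriv (fun t₀ : ℝ => deriv (fun t₂ : ℝ => deriv (fun t₃ : ℝ =>
        Real.log (∫ U, Real.exp (h U - t₀ * X U - t₂ * Y U - t₃ * Z U) ∂μ)) 0) 0) 0 =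
      -(E (fun U => X U * Y U * Z U) - E X * (E (fun U => Y U * Z U) - E Y * E Z)
        - E Y * (E (fun U => X U * Z U) - E X * E Z) - E Z * (E (fun U => X U * Y U) - E X * E Y)
        - E X * E Y * E Z) ∧
    deriv (fun t₀ : ℝ => deriv (fun t₂ : ℝ =>
        Real.log (∫ U, Real.exp (h U - t₀ * X U - t₂ * Y U) ∂μ)) 0) 0 =
      E (fun U => X U * Y U) - E X * E Y := by
  have hb0 := (integral_exp_pos_of_continuous (μ := μ) hh).ne'
  constructor
  · -- innermost derivative (in `t₃`), for all `t₀ t₂`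
    have e3 : ∀ t₀ t₂ : ℝ, deriv (fun t₃ : ℝ =>
        Real.log (∫ U, Real.exp (h U - t₀ * X U - t₂ * Y U - t₃ * Z U) ∂μ)) 0 =
          -(∫ U, Z U * Real.exp (h U - t₀ * X U - t₂ * Y U) ∂μ) /
            ∫ U, Real.exp (h U - t₀ * X U - t₂ * Y U) ∂μ :=
      fun t₀ t₂ => deriv_log_integral_exp_tilt (μ := μ) (H := fun U => h U - t₀ * X U - t₂ * Y U)
        (by fun_prop) hZ
    simp_rw [e3]
    -- middle derivative (in `t₂`), for all `t₀`
    have e2 : ∀ t₀ : ℝ, deriv (fun t₂ : ℝ => -(∫ U, Z U * Real.exp (h U - t₀ * X U - t₂ * Y U) ∂μ) /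
        ∫ U, Real.exp (h U - t₀ * X U - t₂ * Y U) ∂μ) 0 =
          ((∫ U, Y U * Z U * Real.exp (h U - t₀ * X U) ∂μ) * (∫ U, Real.exp (h U - t₀ * X U) ∂μ) -
              (∫ U, Z U * Real.exp (h U - t₀ * X U) ∂μ) * (∫ U, Y U * Real.exp (h U - t₀ * X U) ∂μ)) /
            ((∫ U, Real.exp (h U - t₀ * X U) ∂μ) * (∫ U, Real.exp (h U - t₀ * X U) ∂μ)) :=
      fun t₀ => deriv_neg_tilt_mean (μ := μ) (H := fun U => h U - t₀ * X U) (P := Y) (f := Z)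
        (g := fun U => Y U * Z U) (by fun_prop) hY hZ (fun _ => rfl)
    simp_rw [e2]
    -- outer derivative (in `t₀`) at `0`
    have ha := hasDerivAt_integral_mul_exp_tilt (μ := μ) (f := fun U => Y U * Z U)
      (g := fun U => X U * Y U * Z U) hh hX (hY.mul hZ) (fun U => by ring) 0
    have hb := hasDerivAt_integral_exp_tilt (μ := μ) hh hX 0
    have hc := hasDerivAt_integral_mul_exp_tilt (μ := μ) (f := Z) (g := fun U => X U * Z U) hh hX hZ
      (fun _ => rfl) 0
    have hd := hasDerivAt_integral_mul_exp_tilt (μ := μ) (f := Y) (g := fun U => X U * Y U) hh hX hY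
      (fun _ => rfl) 0
    have key : deriv (fun t : ℝ =>
        ((∫ U, Y U * Z U * Real.exp (h U - t * X U) ∂μ) * (∫ U, Real.exp (h U - t * X U) ∂μ) -
            (∫ U, Z U * Real.exp (h U - t * X U) ∂μ) * (∫ U, Y U * Real.exp (h U - t * X U) ∂μ)) /
          ((∫ U, Real.exp (h U - t * X U) ∂μ) * (∫ U, Real.exp (h U - t * X U) ∂μ))) 0 = _ :=
      (((ha.fun_mul hb).fun_sub (hc.fun_mul hd)).fun_div (hb.fun_mul hb)
        (by simpa only [zero_mul, sub_zero] using mul_ne_zero hb0 hb0)).deriv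
    rw [key]
    simp only [zero_mul, sub_zero, hE]
    field_simp
    ring
  · have e2 : ∀ t₀ : ℝ, deriv (fun t₂ : ℝ => Real.log (∫ U, Real.exp (h U - t₀ * X U - t₂ * Y U) ∂μ)) 0 =
        -(∫ U, Y U * Real.exp (h U - t₀ * X U) ∂μ) / ∫ U, Real.exp (h U - t₀ * X U) ∂μ :=
      fun t₀ => deriv_log_integral_exp_tilt (μ := μ) (H := fun U => h U - t₀ * X U) (by fun_prop) hY
    simp_rw [e2]
    rw [deriv_neg_tilt_mean (μ := μ) hh hX hY (g := fun U => X U * Y U) (fun _ => rfl)]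
    simp only [hE]
    field_simp

end Tilt

/-! ## §2 The torus Wilson state: `PressureCGF` -/

section Wilson

variable {G : Type} [Group G] [TopologicalSpace G] [IsTopologicalGroup G] [CompactSpace G]
  [MeasurableSpace G] [BorelSpace G]

/-- The Wilson state as a tilted product-Haar mean: `E_β[F] = (∫ F e^{−βS} dHaar^{⊗E}) / (∫ e^{−βS} dHaar^{⊗E})`
(`wE_eq_inv_mul_integral` and `E_β[1] = 1`). -/
theorem wE_eq_integral_div (r : LatticeRep G) (L : ℕ) [NeZero L] (β : ℝ) (F : GaugeConfig 4 L G → ℝ) :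
    wE r L β F = (∫ U, F U * Real.exp (-β * wilsonAction (d := 4) (L := L) r.ρ U) ∂piHaar L) /
      ∫ U, Real.exp (-β * wilsonAction (d := 4) (L := L) r.ρ U) ∂piHaar L := by
  have hone : wE r L β (fun _ => (1 : ℝ)) = 1 := by
    haveI := isProbabilityMeasure_wilsonMeasure (d := 4) (L := L) r.ρ r.continuous β
    simp [wE, wilsonExpectation]
  rw [wE_eq_inv_mul_integral] at hone
  simp only [mul_one] at hone
  have hZ : ((partitionFunction (d := 4) (L := L) r.ρ β)⁻¹).toReal =
      (∫ U, Real.exp (-β * wilsonAction (d := 4) (L := L) r.ρ U) ∂piHaar L)⁻¹ :=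
    eq_inv_of_mul_eq_one_left hone
  rw [wE_eq_inv_mul_integral, hZ, inv_mul_eq_div]
  congr 1
  exact integral_congr_ae (ae_of_all _ fun U => mul_comm _ _)

/-- **Stub I `PressureCGF` of the line `coupling-cubic-response`** (cumulant-generating-function identities).  For every
compact `G`, `r`, torus `L`, coupling `β` and separation `n`, with `Z(t) = ∫ exp(−βS − t₀P_0^{01} − t₂P_{ne₂}^{01} −
t₃P_{ne₃}^{01}) dHaar^{⊗E}`: `∂³_{t₀t₂t₃} log Z |₀ = −κ₃(P_0^{01},P_{ne₂}^{01},P_{ne₃}^{01})` and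
`∂²_{t₀t₂} log Z(t₀,t₂,0) |₀ = Cov(P_0^{01},P_{ne₂}^{01})` (parametric differentiation under the integral sign on the
compact configuration space, thrice; `Z > 0`). -/
theorem PressureCGF : ∀ (G : Type) [Group G] [TopologicalSpace G] [IsTopologicalGroup G] [CompactSpace G]
    [MeasurableSpace G] [BorelSpace G] (r : LatticeRep G) (L : ℕ) [NeZero L] (β : ℝ) (n : ℕ),
    deriv (fun t₀ : ℝ => deriv (fun t₂ : ℝ => deriv (fun t₃ : ℝ =>
      Real.log (∫ U, Real.exp (-β * wilsonAction r.ρ U - t₀ * plaq r L 0 0 1 U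
        - t₂ * plaq r L (Pi.single (2 : Fin 4) ((n : ℕ) : ZMod L)) 0 1 U
        - t₃ * plaq r L (Pi.single (3 : Fin 4) ((n : ℕ) : ZMod L)) 0 1 U) ∂piHaar L)) 0) 0) 0
      = -kappa3 r L β n ∧
    deriv (fun t₀ : ℝ => deriv (fun t₂ : ℝ =>
      Real.log (∫ U, Real.exp (-β * wilsonAction r.ρ U - t₀ * plaq r L 0 0 1 U
        - t₂ * plaq r L (Pi.single (2 : Fin 4) ((n : ℕ) : ZMod L)) 0 1 U) ∂piHaar L)) 0) 0
      = wCov r L β (plaq r L 0 0 1) (plaq r L (Pi.single (2 : Fin 4) ((n : ℕ) : ZMod L)) 0 1) := by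
  intro G _ _ _ _ _ _ r L _ β n
  haveI : SecondCountableTopology G :=
    (r.continuous.isClosedEmbedding r.injective).isEmbedding.secondCountableTopology
  have hS : Continuous fun U : GaugeConfig 4 L G => -β * wilsonAction (d := 4) (L := L) r.ρ U :=
    continuous_const.mul (Literature.Barriers.QuantumFields.Elitzur.continuous_wilsonAction r.ρ r.continuous)
  have key := deriv3_deriv2_log_integral_exp (μ := piHaar L) hS (continuous_plaq r L 0 0 1)
    (continuous_plaq r L (Pi.single (2 : Fin 4) ((n : ℕ) : ZMod L)) 0 1)
    (continuous_plaq r L (Pi.single (3 : Fin 4) ((n : ℕ) : ZMod L)) 0 1) (wE r L β)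
    (wE_eq_integral_div r L β)
  dsimp only [kappa3, wCov]
  exact key

end Wilson

end Summit.QuantumFields.YangMills.Theorems.FemtoCurvatureSkewness
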